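import Summits.QuantumFields.YangMills.Theorems.BalabanUVNodesK0AxJoinTKStep
import Summits.QuantumFields.YangMills.Theorems.BalabanUVNodesPortU8LocUnivDecayClause3

/-!
# LANDING NOTE (porter PTC-1 g3, 2026-08-31; AUTHORSHIP = ◇ lens-1 g10 «cauchy-analytic», HOME sketch `nodeO-cover/LENS-1g10-Ra-v1.lean` (PART A) sha16 946871191377377d · 374 l. · 0 sorry;
# ★★★ director-ym №540 (W2 road of record: «→ ◆ cut → porter lands sorry-free pieces»); ◆ CRIT-1 g36 CUT 09:19:31Z: «§1–§3 (`dataG ∕ flipG ∕ …_G ∕ kstep_joinT_at_record_LocUniv`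
# :65–:305) landable AS IS; do NOT file §4 until rider (Q-ord) is fixed»); ★★★ director-ym №543 (1): «LAND §1–§3 NOW, AS IS (… ∕ `TokCmpUCap`, :65–:307) as
# `…/Theorems/BalabanUVNodesK0AxJoinTD9.lean`; §4 `twoVolExp_LocUniv_of_cmp` ONLY after v1.1 with (f2) → second file `…K0AxJoinTD9Cmp.lean`».  THIS FILE `…K0AxJoinTD9.lean` =
# PART A §1–§3 + the (Tok-cmpU-cap) letter `def TokCmpUCap` of §4 VERBATIM (the §4 section docstring is kept as printed): §1 record response data with a GENERIC
# response table `G` (`dataG`, `flipG`, `flipG_e`, `response9D_flipG`, `chart_cut_members_G`); §2 ★★★ `recordTwoVol_of_rows_G` ∕ ★★★ `kstep_joinT_at_record_G` — ✓p817093's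
# JC kernel step with the response table a PARAMETER; §3 ★★★ `kstep_joinT_at_record_LocUniv` — the G-edition at `G := recordGkLocWξ … univ a` with the D9 row BY NAME
# `∀ a, Response9DAtLocUnivξ …` (window letter), the link row on `fderiv (ιC k n) 0`, the swap row vs `recordEmbJ` as an ORBIT statement, D1 at RG histories.  §4 (`TokCmpUCap`,
# verbatim); §4's THEOREM `twoVolExp_LocUniv_of_cmp` is NOT landed here (◆'s (Q-ord) rider: its leaf constants are bound before `∃ δ₀`; it lands re-signed as `…K0AxJoinTD9Cmp`).
# Imports as in the sketch; the author's module docstring follows.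
# HONEST: CONDITIONAL theorems over DISPLAYED rows (D1 = ⟨27930⟩'s ⁸ consequent OPEN; D9-LocUniv ∕ Tok-cmpU-cap OPEN Bałaban content; swap ∕ link ∕ C² rows = (ra-1)(ra-3)(ra-4) +
# `DressLink` ⟸ (C-orb), displayed); [E] inhabited unconditionally NOWHERE; K0ᴬ stmt-QuantumFields-27238 OPEN — NOTHING of it proved; nothing of Bałaban asserted, ported, discharged
# or refuted; NODE O 0∕1; COUNT 8∕28 · K 1∕4 UNMOVED; finite 𝕋⁴ at fixed ε — NOT continuum ∕ OS ∕ Clay; the Yang–Mills mass gap is NOT proved by any of this.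
-/

/-!
# NODE O · K0ᴬ — the D9-XFER row of the JOIN-T kernel step: the response table made GENERIC, then instantiated at the
# TRANSVERSE WHOLE-TORUS table `recordGkLocWξ … Finset.univ` (D9 := `Response9DAtLocUnivξ`, tree mod (Tok-cmpU-cap))

lens-1 (ymgap-nodeO-lens-1 g10), route `BalabanUVNodes`, items K0⁷ `Record13SepCoPHInhabited` (stmt-QuantumFields-20541) ∕ K0ᴬ
`Record13SepCoPHInhabitedAx` (stmt-QuantumFields-27238) — both OPEN; this file proves CONDITIONAL theorems over DISPLAYED rows only.

WHAT.  ✓`K0AxJoinT.kstep_joinT_at_record` (tree, `…K0AxJoinTKStep`) reads its response rows (D9) on ★★ DEF-1's CENTRED-PAIR table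
`recordGkJC` through the receipt `Response9DAtJC`, and ties the abstract chart `ιC` to that table by the link row
`recordGkJC … a l = fun i => fderiv ℝ (ιC k n) 0 (δ_l ⊗ bV a) i`.  But the engine it calls, ✓`twoVol_pvolOf_of_rows_trace`, is GENERIC in the
response table `Gc`: nothing in the kernel step uses WHICH first-order response table the chart has — only (R1ᴰ)∕(R4ᴰ) for that table in the
(4.4) gauges and the link to `Dι(0)`.  §1–§2 retype the kernel step with the table a PARAMETER `G` (★★★ `kstep_joinT_at_record_G`); §3 instantiates
`G := recordGkLocWξ F θ k (recordK₀ F Mc k + n) Finset.univ a` — the TRANSVERSE whole-torus [B6]-(1.63) table of ★ LocC∕LocE — so that the D9 row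
becomes, BY NAME, `∀ a, Response9DAtLocUnivξ F θ a Mc k (recordK₀ F Mc k) α₂ C₉ δ₀` (★★★ `kstep_joinT_at_record_LocUniv`), which ★★★ PTB-1
✓`PortU8.portPieceLocalityU8_LocUniv_of_cmp` INHABITS for every `α₂ > 0` under the displayed (Tok-cmpU-cap) alone; §4 composes the two
(★★★ `twoVolExp_LocUniv_of_cmp`: (Tok-cmpU-cap) ∧ ⁸'s mould ∧ the chart rows for `ιC` against the transverse table ∧ geometry ∧ leaves ⟹ ∃ C₉ δ₀, [E]).

THE TRANSFER CONTENT (what is NOT free).  The link row now reads `recordGkLocWξ … univ a l = Dι_C(0)[δ_l ⊗ bV a]` for a chart `ιC` that ALSO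
satisfies the swap row (exact gauge equivalence, near `B = 0`, of `ιC B` with the record background chart `recordEmbJ B` on every `X`).  PTB-1's own
chart `recordEmbLocξ … univ` has the link row (✓`ResponseRowAtLocξ`) but NOT the swap row (the (2.35) configuration `exp(ξ A′_B)` is gauge
equivalent to the true background only to first order); the centred chart `recordEmbJC` has the swap row but its table is `recordGkJC`, and
`recordGkJC = recordGkLocWξ univ` is the J5′-FORBIDDEN bridge (false-shaped: ◆'s tube term).  The jointly inhabiting chart is the RE-GAUGED
background `B ↦ coords of gaugeAct (exp (ξ·Φ_B)) (recordBgFieldC B)` with `Φ_B` linear in `B`, whose swap row holds by construction and whose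
derivative at `0` is the transverse table iff the ORBIT RECEIPT (X-orb) `CentredResponseOrbitAt` (§5) holds: `D(recordBgFieldC)(0)[δ_l ⊗ bV a] −
ξ·(windowResp univ l ⊗ ρ8 (bV a)) = lattice gradient of an 𝔰𝔲(2)-valued site function`.  (X-orb) is TRUE-SHAPED ([15] (176)+(21): the
derivative of the constrained minimiser is a critical point of the gauge-invariant quadratic form on the comb-linearised constraint, and the
comb-linearised constraint differs from the straight [B6] one `Q_{k+1}` by coarse gradients; so it lies on the gradient orbit of the [B6] minimiser
`windowResp univ` — [B6] (2.12)), M-sized, OPEN here; it REPLACES the centred receipt's OPEN Bałaban content (R1ᴰ)(R4ᴰ) at `recordGkJC`.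

HONEST FRAMING.  CONDITIONAL theorems over DISPLAYED row predicates + PTB-1's checked package; NO `sorry`; nothing of Bałaban ([I] Thm 1,
(1.7), (1.18)–(1.22), (4.33)–(4.37), (5.10); [15] Thm 1, Prop. 9, (176), (190); [B6] (2.35)) is asserted, ported, discharged or refuted beyond
what the cited tree theorems already prove; K0⁷ stmt-QuantumFields-20541 ∕ K0ᴬ stmt-QuantumFields-27238 OPEN; NODE O 0∕1; COUNT 8∕28 · K 1∕4
UNMOVED; finite `𝕋⁴_{L^K}` at fixed ε — NOT continuum ∕ ℝ⁴ ∕ OS ∕ Clay; **the Yang–Mills mass gap is NOT proved by any of this.**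
No `instance`, `notation`, `allowUnsafeReducibility`; standard axioms.
-/

noncomputable section

open Filter Topology
open scoped BigOperators Matrix.Norms.L2Operator

namespace Summit.QuantumFields.YangMills.Theorems.K0AxJoinT

open Literature.MathematicalPhysics.QuantumFieldTheory.Balaban1983to89
open Literature.MathematicalPhysics.QuantumFieldTheory.Balaban1983to89.Node00 (TermFamily1 siteOfInt polWindow polScalar betaOfRecord₁₃Ax Stage13Params)
open Literature.MathematicalPhysics.QuantumFieldTheory.Balaban1983to89.T4Continuum (T4Family)
open Literature.MathematicalPhysics.QuantumFieldTheory.Balaban1983to89.B12FormatPlus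
open Literature.MathematicalPhysics.QuantumFieldTheory.Balaban1983to89.B12Decay510 (SiteGeometry GeomLeaf CubeSumLeaf TreeLeaf KernelBound delta1 mixedDeriv)
open Summit.QuantumFields.YangMills.Theorems.K0RecordFormatNames
open Summit.QuantumFields.YangMills.Theorems.K0AxTwoVolumeRate (RecordPvolTwoVolExpOnRunsAx)
open Summit.QuantumFields.YangMills.Theorems.PortHRecordJoin (formatPlusG_chartSwap chartEquivariant_members noInvariantCovector_members chart_cut)
open Summit.QuantumFields.YangMills.Theorems.K0PortChart44DAtRecord (chart44DJ_record)
open Literature.MathematicalPhysics.QuantumFieldTheory.Balaban1983to89.FlowStep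
open Literature.MathematicalPhysics.QuantumFieldTheory.Balaban1983to89.FlowStepRuns

/-! ## §1  Record response data with a GENERIC response table `G` -/

/-- **`dataG F Mc k K₀ G`** — the record's response data from the base volume `K₀` (every field the record's: cube cover, labels, site geometry,
label metric, window labels `recordE`, chart inputs `recordCXJ`, `recordSiteOfJ`, `recordWrapCtr`, `recordDomEmbCtr`, `recordJXJ`, `recordCoordProjCtr`)
with the RESPONSE TABLE a parameter `G`.  At `G := fun n => recordGkLocWξ F θ k (K₀+n) Finset.univ a` it is ★ LocE's `recordResponse9DataFromLocUnivξ`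
(definitionally); at `G := fun n => recordGkJC … a`, ★★ DEF-1's `recordResponse9DataFromJC`. [cite: Balaban1987RG1, (1.21) p.264, (4.35) p.290; Balaban1985Variational, Prop. 9 p.309] -/
def dataG (F : T4Family) (Mc k K₀ : ℕ) (G : (n : ℕ) → RespLabel F k (K₀ + n) → Fin (recordChartDimJ F (K₀ + n)) → ℂ) :
    Response9Data (fun n => recordDomSys F Mc k (K₀ + n)) (fun n => recordBondCount F (K₀ + n)) (fun n => recordChartDimJ F (K₀ + n)) 4 where
  Cc := fun n => recordCc F Mc k (K₀ + n)
  Λ := fun n => RespLabel F k (K₀ + n)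
  G := fun n => recordSiteGeom F Mc k (K₀ + n)
  ρ := fun n => recordRho F k (K₀ + n)
  e := fun n => recordE F k (K₀ + n)
  cX := fun n => recordCXJ F Mc k (K₀ + n)
  siteOf := fun n => recordSiteOfJ F k (K₀ + n)
  Gk := G
  wrap := fun n => recordWrapCtr F Mc k (K₀ + n)
  emb := fun n => recordDomEmbCtr F Mc k (K₀ + n)
  jX := fun n _ => recordJXJ F (K₀ + n)
  πc := fun n _ => recordCoordProjCtr F (K₀ + n)

/-- **`flipG`** — `dataG` with the WINDOW LABELS in ★★★'s convention `e n μ z := (μ, siteOfInt z)` (the JOIN's `flipL ∕ flipJC` device, verbatim).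
[cite: Balaban1987RG1, (1.21) p.264 (bookkeeping)] -/
def flipG (F : T4Family) (Mc k K₀ : ℕ) (G : (n : ℕ) → RespLabel F k (K₀ + n) → Fin (recordChartDimJ F (K₀ + n)) → ℂ) :
    Response9Data (fun n => recordDomSys F Mc k (K₀ + n)) (fun n => recordBondCount F (K₀ + n)) (fun n => recordChartDimJ F (K₀ + n)) 4 :=
  { dataG F Mc k K₀ G with
    e := fun n μ z => (Fin.cast (F.P_d (K₀ + n)).symm μ, siteOfInt F (K₀ + n) (k + 1) z) }

/-- The flipped label IS the record label at `−z`. [cite: Balaban1987RG1, (1.21) p.264 (bookkeeping)] -/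
theorem flipG_e (F : T4Family) (Mc k K₀ n : ℕ) (G : (n : ℕ) → RespLabel F k (K₀ + n) → Fin (recordChartDimJ F (K₀ + n)) → ℂ)
    (μ : Fin 4) (z : Fin 4 → ℤ) : (flipG F Mc k K₀ G).e n μ z = recordE F k (K₀ + n) μ (-z) := by
  simp only [flipG, recordE, neg_neg]

/-- A «Prop. 9» receipt for `dataG … G` (window labels `recordE`) transfers to `flipG … G` — only (R4ᴰ) reads `e`, under a `|·|`-symmetric window guard.
[cite: Balaban1985Variational, Prop. 9 p.309; Balaban1987RG1, (1.21) p.264, (4.4) p.281] -/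
theorem response9D_flipG (F : T4Family) (Mc k K₀ : ℕ) (G : (n : ℕ) → RespLabel F k (K₀ + n) → Fin (recordChartDimJ F (K₀ + n)) → ℂ) {α₂ C₉ δ₀ : ℝ}
    (h : Response9D (dataG F Mc k K₀ G) (fun n => recordChartJ F Mc k (K₀ + n)) (fun n => recordRNat F Mc k (K₀ + n))
      (fun n X => recordDom44J F Mc k (K₀ + n) X α₂) C₉ δ₀) :
    Response9D (flipG F Mc k K₀ G) (fun n => recordChartJ F Mc k (K₀ + n)) (fun n => recordRNat F Mc k (K₀ + n))
      (fun n X => recordDom44J F Mc k (K₀ + n) X α₂) C₉ δ₀ := by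
  obtain ⟨h0, h1, hR1, hR3, hR4, hR5⟩ := h
  refine ⟨h0, h1, hR1, hR3, fun n X hX μ z hz => ?_, hR5⟩
  have hz' : ∀ l, 2 * |(-z) l| < (recordRNat F Mc k (K₀ + n) : ℤ) := fun l => by simpa only [Pi.neg_apply, abs_neg] using hz l
  have h4 := hR4 n X hX μ (-z) hz'
  simp only [flipG_e]
  exact h4

/-- Cut-locality at the members for `flipG`'s `cX` (= `recordCXJ`, definitional), every `coords`. [cite: Balaban1987RG1, (4.35) p.290] -/
theorem chart_cut_members_G (F : T4Family) (Mc k K₀ : ℕ) (G : (n : ℕ) → RespLabel F k (K₀ + n) → Fin (recordChartDimJ F (K₀ + n)) → ℂ)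
    (coords : (n : ℕ) → (recordDomSys F Mc k (K₀ + n)).Dom → Finset (Fin (recordBondCount F (K₀ + n)))) :
    ∀ n X u, ∀ i ∈ coords n X,
      recordChartJ F Mc k (K₀ + n) X (cutTo ((flipG F Mc k K₀ G).cX n X) u) i = recordChartJ F Mc k (K₀ + n) X u i := by
  intro n X u i _
  show recordChartJ F Mc k (K₀ + n) X (cutTo (recordCXJ F Mc k (K₀ + n) X) u) i = _
  rw [chart_cut]

/-! ## §2  ★★★ The kernel step with a GENERIC response table -/

/-- ★★★ **MEMBER LEVEL, ONE CHART `ιC`, GENERIC TABLE `G`** — ✓`twoVol_pvolOf_of_rows_trace` at the record names with `R := flipG … (G · a⋆)`, `Gc n a := G n a`: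
⁸'s mould at `recordEmbJ` ∧ the swap row to `ιC` ∧ per colour a «Prop. 9» receipt for `dataG … (G · a)` ∧ `ιC` is `C²` at `0` with `ιC 0 = 0` ∧ the link
`G n a l = Dι_C(0)[δ_l ⊗ bV a]` ∧ geometry (G0)–(G3) ∧ leaves ⟹ the two-rate bound on the members' increments, eventually.  (✓`recordTwoVol_of_rows_JC` is the
case `G := recordGkJC`.)  CONDITIONAL over displayed rows; nothing of Bałaban asserted.
[cite: Balaban1987RG1, (1.21) p.264, (1.18)–(1.19) p.263, (1.7) p.261, (4.14) p.284, (4.35)–(4.37) pp.290–291, (5.10) p.293; Balaban1985Variational, Prop. 9 p.309] -/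
theorem recordTwoVol_of_rows_G {E₀ κ C₉ δ₀ Mg c₁ K₀' K₁ : ℝ}
    (hE₀ : 0 ≤ E₀) (hκ : 0 < κ) (hC₉ : 0 ≤ C₉) (hδ₀ : 0 < δ₀) (hMg : 0 < Mg) (hK₀' : 0 ≤ K₀') :
    ∀ (F : T4Family) (a₀ ε₂₉ α₀ α₁ : ℝ), 0 < α₀ → 0 < α₁ → ∀ (Mc k : ℕ) (v : Fin (k + 1) → ℝ) (Nin : ℕ → ℕ) (Rsep : ℕ → ℝ),
      letI θ := thetaFill F a₀ ε₂₉; letI := θ.instVβ₁; letI := θ.instVβ₂; letI := θ.instιβ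
      ∀ (ιC : (n : ℕ) → recordW F a₀ ε₂₉ k (recordK₀ F Mc k + n) → (Fin (recordChartDimJ F (recordK₀ F Mc k + n)) → ℂ))
        (G : (n : ℕ) → θ.ιβ → RespLabel F k (recordK₀ F Mc k + n) → Fin (recordChartDimJ F (recordK₀ F Mc k + n)) → ℂ),
      B12FormatPlus.FormatPlusG (fun n => recordDomSys F Mc k (recordK₀ F Mc k + n)) (fun n => recordBondCount F (recordK₀ F Mc k + n))
          (fun n => recordAct F (recordK₀ F Mc k + n)) (fun n => recordUc F Mc k α₀ α₁ (recordK₀ F Mc k + n))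
          (fun n => recordCoords F Mc k (recordK₀ F Mc k + n)) (fun n => recordChartDimJ F (recordK₀ F Mc k + n))
          (fun n => recordChartJ F Mc k (recordK₀ F Mc k + n)) (fun n => recordΦfAx F a₀ ε₂₉ k v (recordK₀ F Mc k + n))
          (fun n => recordEmbJ F θ k (recordK₀ F Mc k + n)) (fun n => recordWrapCtr F Mc k (recordK₀ F Mc k + n))
          (fun n => recordDomEmbCtr F Mc k (recordK₀ F Mc k + n)) (fun n _ => recordCoordProjCtr F (recordK₀ F Mc k + n)) E₀ κ →
      (∀ n : ℕ, ∀ᶠ B in 𝓝 (0 : recordW F a₀ ε₂₉ k (recordK₀ F Mc k + n)), ∀ X : (recordDomSys F Mc k (recordK₀ F Mc k + n)).Dom,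
          ∃ g : recordGaugeGrp F (recordK₀ F Mc k + n), ∀ i ∈ recordCoords F Mc k (recordK₀ F Mc k + n) X,
            recordChartJ F Mc k (recordK₀ F Mc k + n) X (ιC n B) i =
              recordAct F (recordK₀ F Mc k + n) g (recordChartJ F Mc k (recordK₀ F Mc k + n) X (recordEmbJ F θ k (recordK₀ F Mc k + n) B)) i) →
      (∀ a : θ.ιβ, Response9D (dataG F Mc k (recordK₀ F Mc k) (fun n => G n a)) (fun n => recordChartJ F Mc k (recordK₀ F Mc k + n))
          (fun n => recordRNat F Mc k (recordK₀ F Mc k + n)) (fun n X => recordDom44J F Mc k (recordK₀ F Mc k + n) X (min (1 / 4 : ℝ) (min α₁ (α₀ / 36)))) C₉ δ₀) →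
      (∀ n : ℕ, ContDiffAt ℝ 2 (ιC n) 0 ∧ ιC n 0 = 0) →
      (∀ (n : ℕ) (a : θ.ιβ) (l : RespLabel F k (recordK₀ F Mc k + n)),
          G n a l = fun i => fderiv ℝ (ιC n) 0 (Pi.single l.1 (Pi.single l.2 (θ.bV a))) i) →
      (∀ n : ℕ, Set.InjOn (recordDomEmbCtr F Mc k (recordK₀ F Mc k + n)) {X | X ∉ recordWrapCtr F Mc k (recordK₀ F Mc k + n)}) →
      (∀ (n : ℕ) (X : (recordDomSys F Mc k (recordK₀ F Mc k + n)).Dom), X ∈ recordWrapCtr F Mc k (recordK₀ F Mc k + n) →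
          ∀ (μ : Fin 4) (z : Fin 4 → ℤ), (∀ l, 2 * |z l| < (Nin n : ℤ)) →
            Rsep n ≤ (recordSiteGeom F Mc k (recordK₀ F Mc k + n)).distD (recordE F k (recordK₀ F Mc k + n) μ z) X +
              Mg * ((recordDomSys F Mc k (recordK₀ F Mc k + n)).dj X + c₁)) →
      (∀ (n : ℕ) (X' : (recordDomSys F Mc k (recordK₀ F Mc k + (n + 1))).Dom),
          (∀ X, X ∉ recordWrapCtr F Mc k (recordK₀ F Mc k + n) → recordDomEmbCtr F Mc k (recordK₀ F Mc k + n) X ≠ X') →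
          ∀ (μ : Fin 4) (z : Fin 4 → ℤ), (∀ l, 2 * |z l| < (Nin n : ℤ)) →
            Rsep n ≤
              (recordSiteGeom F Mc k (recordK₀ F Mc k + (n + 1))).distD (recordE F k (recordK₀ F Mc k + (n + 1)) μ z) X' +
                Mg * ((recordDomSys F Mc k (recordK₀ F Mc k + (n + 1))).dj X' + c₁)) →
      (∀ n : ℕ, Nin n ≤ recordRNat F Mc k (recordK₀ F Mc k + n)) → (∀ z : Fin 4 → ℤ, ∀ᶠ n in atTop, ∀ l, 2 * |z l| < (Nin n : ℤ)) →
      (∀ n : ℕ, B12Decay510.CubeSumLeaf (recordSiteGeom F Mc k (recordK₀ F Mc k + n)) (δ₀ / 4) K₁ ∧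
          B12Decay510.TreeLeaf (recordCc F Mc k (recordK₀ F Mc k + n)) (κ / 4) K₀') →
      ∀ (μ ν : Fin 4) (z : Fin 4 → ℤ), ∀ᶠ m in atTop,
        |recordPvolAx F a₀ ε₂₉ k v (recordK₀ F Mc k + (m + 1)) μ ν z - recordPvolAx F a₀ ε₂₉ k v (recordK₀ F Mc k + m) μ ν z| ≤
          48 * E₀ * C₉ ^ 2 * K₀' * K₁ * Real.exp (-δ₀ * (recordRNat F Mc k (recordK₀ F Mc k + m) : ℝ) / 2) +
            32 * E₀ * C₉ ^ 2 * Real.exp (B12Decay510.delta1 δ₀ κ Mg * Mg * c₁) * K₀' * K₁ *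
              Real.exp (-(B12Decay510.delta1 δ₀ κ Mg) * Rsep m) := by
  classical
  intro F a₀ ε₂₉ α₀ α₁ hα₀ hα₁ Mc k v Nin Rsep ιC G hFmt hsw hResp hreg hGk hinj hsepW hsepF hNin hwin hleaf μ ν z
  letI θ := thetaFill F a₀ ε₂₉; letI := θ.instVβ₁; letI := θ.instVβ₂; letI := θ.instιβ
  have hFmtC := formatPlusG_chartSwap hFmt hsw
  have hnegW : ∀ (n : ℕ) (z : Fin 4 → ℤ), (∀ l, 2 * |z l| < (Nin n : ℤ)) → ∀ l, 2 * |(-z) l| < (Nin n : ℤ) := fun n z hz l => by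
    simpa only [Pi.neg_apply, abs_neg] using hz l
  filter_upwards [hwin z] with m hm
  refine twoVol_pvolOf_of_rows_trace F (recordTermsAx F a₀ ε₂₉) θ.ρ8 θ.bV k v
    (fun n => recordUc F Mc k α₀ α₁ (recordK₀ F Mc k + n)) (fun n => recordCoords F Mc k (recordK₀ F Mc k + n))
    (fun n => recordChartJ F Mc k (recordK₀ F Mc k + n))
    (fun n X => recordDom44J F Mc k (recordK₀ F Mc k + n) X (min (1 / 4 : ℝ) (min α₁ (α₀ / 36))))
    (fun n => recordAct F (recordK₀ F Mc k + n)) (fun n => recordToG F (recordK₀ F Mc k + n)) (fun n => recordAdJ F (recordK₀ F Mc k + n))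
    (flipG F Mc k (recordK₀ F Mc k) (fun n => G n (recordAStar F a₀ ε₂₉))) (fun n => recordK₀ F Mc k + n)
    (fun n a (y : RespLabel F k (recordK₀ F Mc k + n)) => G n a y) ιC
    (N := fun n => recordRNat F Mc k (recordK₀ F Mc k + n)) (Nin := Nin) (Rsep := Rsep) (K₁ := K₁)
    hE₀ hκ.le hC₉ hδ₀.le hMg hK₀' hFmtC (chart44DJ_record F Mc k hα₀ hα₁)
    (chartEquivariant_members Mc k (recordK₀ F Mc k)) (noInvariantCovector_members (recordK₀ F Mc k))
    (chart_cut_members_G F Mc k (recordK₀ F Mc k) (fun n => G n (recordAStar F a₀ ε₂₉)) _)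
    ?_ ?_ ?_ ?_ hinj hNin ?_ ?_ (fun n => (hleaf n).1) (fun n => (hleaf n).2) ?_ m μ ν z hm
  · exact fun n a X y => (response9D_flipG F Mc k (recordK₀ F Mc k) (fun n => G n a) (hResp a)).2.2.1 n X y
  · exact (response9D_flipG F Mc k (recordK₀ F Mc k) (fun n => G n (recordAStar F a₀ ε₂₉)) (hResp _)).2.2.2.1
  · exact fun n a X hX μ' z' hz' => (response9D_flipG F Mc k (recordK₀ F Mc k) (fun n => G n a) (hResp a)).2.2.2.2.1 n X hX μ' z' hz'
  · exact (response9D_flipG F Mc k (recordK₀ F Mc k) (fun n => G n (recordAStar F a₀ ε₂₉)) (hResp _)).2.2.2.2.2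
  · intro n X hX μ' z' hz'
    rw [flipG_e]
    exact hsepW n X hX μ' (-z') (hnegW n z' hz')
  · intro n X' hX' μ' z' hz'
    rw [flipG_e]
    exact hsepF n X' hX' μ' (-z') (hnegW n z' hz')
  · exact fun n => ⟨(hreg n).2, (hreg n).1, fun a μ' z' => hGk n a _⟩

/-- ★★★ **`kstep_joinT_at_record_G` — RUN LEVEL, GENERIC RESPONSE TABLE `G`** (✓`kstep_joinT_at_record` is the case `G := recordGkJC`): ONE chart `ιC`; ⁸'s consequent AS
SIGNED along `]0, γ₀]`-runs (D1) · the swap row to `ιC` · per `k`: a «Prop. 9» receipt for `dataG … (G k · a)` per colour ∧ `ιC k n` is `C²` at `0` with value `0` ∧ the link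
`G k n a l = Dι_C(0)[δ_l ⊗ bV a]` · geometry (G0)–(G4) · leaves ⟹ [E] `RecordPvolTwoVolExpOnRunsAx F a₀ ε₂₉ γ₀ (48E₀C₉²K₀′K₁ + 32E₀C₉²e^{δ₁Mg c₁}K₀′K₁) (δ₁·cR)`.
CONDITIONAL: every displayed row is a hypothesis; nothing of Bałaban asserted; K0ᴬ 27238 OPEN; the Yang–Mills mass gap is NOT proved.
[cite: Balaban1987RG1, Thm 1 p.259, (1.7) p.261, (1.18)–(1.22) pp.263–264, (4.4)–(4.5) pp.281–282, (4.14) p.284, (4.35)–(4.37) pp.290–291; Balaban1985Variational, Prop. 9 p.309, (190) p.308] -/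
theorem kstep_joinT_at_record_G {E₀ κ C₉ δ₀ Mg c₁ K₀' K₁ : ℝ}
    (hE₀ : 0 ≤ E₀) (hκ : 0 < κ) (hC₉ : 0 ≤ C₉) (hδ₀ : 0 < δ₀) (hMg : 0 < Mg) (hK₀' : 0 ≤ K₀') :
    ∀ (F : T4Family) (a₀ ε₂₉ γ₀ α₀ α₁ : ℝ), 0 < α₀ → 0 < α₁ → ∀ (Mc : ℕ) (Nin : ℕ → ℕ → ℕ) (Rsep : ℕ → ℕ → ℝ) (cR : ℝ), 0 < cR → cR ≤ 1 / 4 →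
      letI θ := thetaFill F a₀ ε₂₉; letI := θ.instVβ₁; letI := θ.instVβ₂; letI := θ.instιβ
      ∀ (ιC : (k n : ℕ) → recordW F a₀ ε₂₉ k (recordK₀ F Mc k + n) → (Fin (recordChartDimJ F (recordK₀ F Mc k + n)) → ℂ))
        (G : (k n : ℕ) → θ.ιβ → RespLabel F k (recordK₀ F Mc k + n) → Fin (recordChartDimJ F (recordK₀ F Mc k + n)) → ℂ),
      (∀ (k : ℕ) (g : ℕ → ℝ), FlowStep.RGEqH k (betaOfRecord₁₃Ax F 2 (thetaFill F a₀ ε₂₉)) g → Step.InInterval γ₀ k g →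
        B12FormatPlus.FormatPlusG (fun n => recordDomSys F Mc k (recordK₀ F Mc k + n)) (fun n => recordBondCount F (recordK₀ F Mc k + n))
          (fun n => recordAct F (recordK₀ F Mc k + n)) (fun n => recordUc F Mc k α₀ α₁ (recordK₀ F Mc k + n))
          (fun n => recordCoords F Mc k (recordK₀ F Mc k + n)) (fun n => recordChartDimJ F (recordK₀ F Mc k + n))
          (fun n => recordChartJ F Mc k (recordK₀ F Mc k + n)) (fun n => recordΦfAx F a₀ ε₂₉ k (FlowStep.prefixOf g k) (recordK₀ F Mc k + n))
          (fun n => recordEmbJ F θ k (recordK₀ F Mc k + n)) (fun n => recordWrapCtr F Mc k (recordK₀ F Mc k + n))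
          (fun n => recordDomEmbCtr F Mc k (recordK₀ F Mc k + n)) (fun n _ => recordCoordProjCtr F (recordK₀ F Mc k + n)) E₀ κ) →
      (∀ (k n : ℕ), ∀ᶠ B in 𝓝 (0 : recordW F a₀ ε₂₉ k (recordK₀ F Mc k + n)), ∀ X : (recordDomSys F Mc k (recordK₀ F Mc k + n)).Dom,
          ∃ g : recordGaugeGrp F (recordK₀ F Mc k + n), ∀ i ∈ recordCoords F Mc k (recordK₀ F Mc k + n) X,
            recordChartJ F Mc k (recordK₀ F Mc k + n) X (ιC k n B) i =
              recordAct F (recordK₀ F Mc k + n) g (recordChartJ F Mc k (recordK₀ F Mc k + n) X (recordEmbJ F θ k (recordK₀ F Mc k + n) B)) i) →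
      (∀ k : ℕ, (∀ a : θ.ιβ, Response9D (dataG F Mc k (recordK₀ F Mc k) (fun n => G k n a)) (fun n => recordChartJ F Mc k (recordK₀ F Mc k + n))
            (fun n => recordRNat F Mc k (recordK₀ F Mc k + n)) (fun n X => recordDom44J F Mc k (recordK₀ F Mc k + n) X (min (1 / 4 : ℝ) (min α₁ (α₀ / 36)))) C₉ δ₀) ∧
          (∀ n : ℕ, ContDiffAt ℝ 2 (ιC k n) 0 ∧ ιC k n 0 = 0) ∧
          ∀ (n : ℕ) (a : θ.ιβ) (l : RespLabel F k (recordK₀ F Mc k + n)),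
            G k n a l = fun i => fderiv ℝ (ιC k n) 0 (Pi.single l.1 (Pi.single l.2 (θ.bV a))) i) →
      (∀ k n : ℕ, Set.InjOn (recordDomEmbCtr F Mc k (recordK₀ F Mc k + n)) {X | X ∉ recordWrapCtr F Mc k (recordK₀ F Mc k + n)}) →
      (∀ (k n : ℕ) (X : (recordDomSys F Mc k (recordK₀ F Mc k + n)).Dom), X ∈ recordWrapCtr F Mc k (recordK₀ F Mc k + n) →
          ∀ (μ : Fin 4) (z : Fin 4 → ℤ), (∀ l, 2 * |z l| < (Nin k n : ℤ)) →
            Rsep k n ≤ (recordSiteGeom F Mc k (recordK₀ F Mc k + n)).distD (recordE F k (recordK₀ F Mc k + n) μ z) X +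
              Mg * ((recordDomSys F Mc k (recordK₀ F Mc k + n)).dj X + c₁)) →
      (∀ (k n : ℕ) (X' : (recordDomSys F Mc k (recordK₀ F Mc k + (n + 1))).Dom),
          (∀ X, X ∉ recordWrapCtr F Mc k (recordK₀ F Mc k + n) → recordDomEmbCtr F Mc k (recordK₀ F Mc k + n) X ≠ X') →
          ∀ (μ : Fin 4) (z : Fin 4 → ℤ), (∀ l, 2 * |z l| < (Nin k n : ℤ)) →
            Rsep k n ≤
              (recordSiteGeom F Mc k (recordK₀ F Mc k + (n + 1))).distD (recordE F k (recordK₀ F Mc k + (n + 1)) μ z) X' +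
                Mg * ((recordDomSys F Mc k (recordK₀ F Mc k + (n + 1))).dj X' + c₁)) →
      (∀ k n : ℕ, Nin k n ≤ recordRNat F Mc k (recordK₀ F Mc k + n)) → (∀ (k : ℕ) (z : Fin 4 → ℤ), ∀ᶠ n in atTop, ∀ l, 2 * |z l| < (Nin k n : ℤ)) →
      (∀ k n : ℕ, cR * (recordN F k (recordK₀ F Mc k + n) : ℝ) ≤ Rsep k n ∧
          (recordN F k (recordK₀ F Mc k + n) : ℝ) / 4 ≤ (recordRNat F Mc k (recordK₀ F Mc k + n) : ℝ)) →
      (∀ k n : ℕ, B12Decay510.CubeSumLeaf (recordSiteGeom F Mc k (recordK₀ F Mc k + n)) (δ₀ / 4) K₁ ∧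
          B12Decay510.TreeLeaf (recordCc F Mc k (recordK₀ F Mc k + n)) (κ / 4) K₀') →
      RecordPvolTwoVolExpOnRunsAx F a₀ ε₂₉ γ₀
        (48 * E₀ * C₉ ^ 2 * K₀' * K₁ + 32 * E₀ * C₉ ^ 2 * Real.exp (B12Decay510.delta1 δ₀ κ Mg * Mg * c₁) * K₀' * K₁) (B12Decay510.delta1 δ₀ κ Mg * cR) := by
  intro F a₀ ε₂₉ γ₀ α₀ α₁ hα₀ hα₁ Mc Nin Rsep cR hcR hcR4 ιC G h8 hsw h9 hinj hsepW hsepF hNin hwin hNR hleaf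
  have hK₁ : 0 ≤ K₁ :=
    (Finset.sum_nonneg fun c _ => (Real.exp_pos _).le).trans ((hleaf 0 0).1 (recordE F 0 (recordK₀ F Mc 0 + 0) 0 0))
  have hA : 0 ≤ 48 * E₀ * C₉ ^ 2 * K₀' * K₁ := by positivity
  have hB : 0 ≤ 32 * E₀ * C₉ ^ 2 * Real.exp (B12Decay510.delta1 δ₀ κ Mg * Mg * c₁) * K₀' * K₁ := by positivity
  refine recordPvolTwoVolExpOnRunsAx_of_members F a₀ ε₂₉ γ₀ Mc Rsep hA hB (B12Decay510.delta1_pos hδ₀ hκ hMg)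
    (B12Decay510.delta1_le_half δ₀ κ Mg) hcR hcR4 hNR fun n gs hrg hin k hk μ ν z => ?_
  have hrgk : FlowStep.RGEqH k (betaOfRecord₁₃Ax F 2 (thetaFill F a₀ ε₂₉)) gs := fun i hi => hrg i (lt_of_lt_of_le hi hk)
  have hink : Step.InInterval γ₀ k gs := fun i hi => hin i (hi.trans hk)
  exact recordTwoVol_of_rows_G hE₀ hκ hC₉ hδ₀ hMg hK₀' F a₀ ε₂₉ α₀ α₁ hα₀ hα₁ Mc k (FlowStep.prefixOf gs k) (Nin k) (Rsep k) (ιC k) (G k)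
    (h8 k gs hrgk hink) (hsw k) (h9 k).1 (h9 k).2.1 (h9 k).2.2 (hinj k) (hsepW k) (hsepF k) (hNin k) (hwin k) (hleaf k) μ ν z


/-! ## §3  ★★★ The kernel step with D9 := the TRANSVERSE WHOLE-TORUS receipt `Response9DAtLocUnivξ` (BY NAME) -/

/-- ★★★ **`kstep_joinT_at_record_LocUniv` — THE D9-XFER EDITION OF THE KERNEL STEP.**  ✓`kstep_joinT_at_record_G` at the transverse whole-torus table
`G k n a := recordGkLocWξ F θ k (recordK₀ F Mc k + n) Finset.univ a` (★ LocC: `ξ·(windowResp univ l ⊗ ρ8 (bV a))` in the 𝐔-block, its current in the 𝐉-block): the D9 row is now,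
BY NAME, ★ LocE's `∀ a, Response9DAtLocUnivξ F θ a Mc k (recordK₀ F Mc k) α₂ C₉ δ₀` — INHABITED for every `α₂ > 0` under (Tok-cmpU-cap) by ★★★ PTB-1
✓`PortU8.portPieceLocalityU8_LocUniv_of_cmp` (§4 composes) — and the link row ties the ONE chart `ιC` (swap row displayed, as before) to THAT table.  Every other row is
✓`kstep_joinT_at_record`'s verbatim.  CONDITIONAL: every displayed row is a hypothesis; nothing of Bałaban asserted; K0ᴬ 27238 OPEN; the Yang–Mills mass gap is NOT proved.
[cite: Balaban1987RG1, Thm 1 p.259, (1.7) p.261, (1.18)–(1.22) pp.263–264, (4.4)–(4.5) pp.281–282, (4.35)–(4.37) pp.290–291; Balaban1985Variational, Prop. 9 p.309, (190) p.308; Balaban1984PropagatorsII, (2.35) p.228] -/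
theorem kstep_joinT_at_record_LocUniv {E₀ κ C₉ δ₀ Mg c₁ K₀' K₁ : ℝ}
    (hE₀ : 0 ≤ E₀) (hκ : 0 < κ) (hC₉ : 0 ≤ C₉) (hδ₀ : 0 < δ₀) (hMg : 0 < Mg) (hK₀' : 0 ≤ K₀') :
    ∀ (F : T4Family) (a₀ ε₂₉ γ₀ α₀ α₁ : ℝ), 0 < α₀ → 0 < α₁ → ∀ (Mc : ℕ) (Nin : ℕ → ℕ → ℕ) (Rsep : ℕ → ℕ → ℝ) (cR : ℝ), 0 < cR → cR ≤ 1 / 4 →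
      letI θ := thetaFill F a₀ ε₂₉; letI := θ.instVβ₁; letI := θ.instVβ₂; letI := θ.instιβ
      ∀ (ιC : (k n : ℕ) → recordW F a₀ ε₂₉ k (recordK₀ F Mc k + n) → (Fin (recordChartDimJ F (recordK₀ F Mc k + n)) → ℂ)),
      (∀ (k : ℕ) (g : ℕ → ℝ), FlowStep.RGEqH k (betaOfRecord₁₃Ax F 2 (thetaFill F a₀ ε₂₉)) g → Step.InInterval γ₀ k g →
        B12FormatPlus.FormatPlusG (fun n => recordDomSys F Mc k (recordK₀ F Mc k + n)) (fun n => recordBondCount F (recordK₀ F Mc k + n))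
          (fun n => recordAct F (recordK₀ F Mc k + n)) (fun n => recordUc F Mc k α₀ α₁ (recordK₀ F Mc k + n))
          (fun n => recordCoords F Mc k (recordK₀ F Mc k + n)) (fun n => recordChartDimJ F (recordK₀ F Mc k + n))
          (fun n => recordChartJ F Mc k (recordK₀ F Mc k + n)) (fun n => recordΦfAx F a₀ ε₂₉ k (FlowStep.prefixOf g k) (recordK₀ F Mc k + n))
          (fun n => recordEmbJ F θ k (recordK₀ F Mc k + n)) (fun n => recordWrapCtr F Mc k (recordK₀ F Mc k + n))
          (fun n => recordDomEmbCtr F Mc k (recordK₀ F Mc k + n)) (fun n _ => recordCoordProjCtr F (recordK₀ F Mc k + n)) E₀ κ) →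
      (∀ (k n : ℕ), ∀ᶠ B in 𝓝 (0 : recordW F a₀ ε₂₉ k (recordK₀ F Mc k + n)), ∀ X : (recordDomSys F Mc k (recordK₀ F Mc k + n)).Dom,
          ∃ g : recordGaugeGrp F (recordK₀ F Mc k + n), ∀ i ∈ recordCoords F Mc k (recordK₀ F Mc k + n) X,
            recordChartJ F Mc k (recordK₀ F Mc k + n) X (ιC k n B) i =
              recordAct F (recordK₀ F Mc k + n) g (recordChartJ F Mc k (recordK₀ F Mc k + n) X (recordEmbJ F θ k (recordK₀ F Mc k + n) B)) i) →
      (∀ k : ℕ, (∀ a : θ.ιβ, Response9DAtLocUnivξ F θ a Mc k (recordK₀ F Mc k) (min (1 / 4 : ℝ) (min α₁ (α₀ / 36))) C₉ δ₀) ∧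
          (∀ n : ℕ, ContDiffAt ℝ 2 (ιC k n) 0 ∧ ιC k n 0 = 0) ∧
          ∀ (n : ℕ) (a : θ.ιβ) (l : RespLabel F k (recordK₀ F Mc k + n)),
            recordGkLocWξ F θ k (recordK₀ F Mc k + n) Finset.univ a l = fun i => fderiv ℝ (ιC k n) 0 (Pi.single l.1 (Pi.single l.2 (θ.bV a))) i) →
      (∀ k n : ℕ, Set.InjOn (recordDomEmbCtr F Mc k (recordK₀ F Mc k + n)) {X | X ∉ recordWrapCtr F Mc k (recordK₀ F Mc k + n)}) →
      (∀ (k n : ℕ) (X : (recordDomSys F Mc k (recordK₀ F Mc k + n)).Dom), X ∈ recordWrapCtr F Mc k (recordK₀ F Mc k + n) →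
          ∀ (μ : Fin 4) (z : Fin 4 → ℤ), (∀ l, 2 * |z l| < (Nin k n : ℤ)) →
            Rsep k n ≤ (recordSiteGeom F Mc k (recordK₀ F Mc k + n)).distD (recordE F k (recordK₀ F Mc k + n) μ z) X +
              Mg * ((recordDomSys F Mc k (recordK₀ F Mc k + n)).dj X + c₁)) →
      (∀ (k n : ℕ) (X' : (recordDomSys F Mc k (recordK₀ F Mc k + (n + 1))).Dom),
          (∀ X, X ∉ recordWrapCtr F Mc k (recordK₀ F Mc k + n) → recordDomEmbCtr F Mc k (recordK₀ F Mc k + n) X ≠ X') →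
          ∀ (μ : Fin 4) (z : Fin 4 → ℤ), (∀ l, 2 * |z l| < (Nin k n : ℤ)) →
            Rsep k n ≤
              (recordSiteGeom F Mc k (recordK₀ F Mc k + (n + 1))).distD (recordE F k (recordK₀ F Mc k + (n + 1)) μ z) X' +
                Mg * ((recordDomSys F Mc k (recordK₀ F Mc k + (n + 1))).dj X' + c₁)) →
      (∀ k n : ℕ, Nin k n ≤ recordRNat F Mc k (recordK₀ F Mc k + n)) → (∀ (k : ℕ) (z : Fin 4 → ℤ), ∀ᶠ n in atTop, ∀ l, 2 * |z l| < (Nin k n : ℤ)) →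
      (∀ k n : ℕ, cR * (recordN F k (recordK₀ F Mc k + n) : ℝ) ≤ Rsep k n ∧
          (recordN F k (recordK₀ F Mc k + n) : ℝ) / 4 ≤ (recordRNat F Mc k (recordK₀ F Mc k + n) : ℝ)) →
      (∀ k n : ℕ, B12Decay510.CubeSumLeaf (recordSiteGeom F Mc k (recordK₀ F Mc k + n)) (δ₀ / 4) K₁ ∧
          B12Decay510.TreeLeaf (recordCc F Mc k (recordK₀ F Mc k + n)) (κ / 4) K₀') →
      RecordPvolTwoVolExpOnRunsAx F a₀ ε₂₉ γ₀
        (48 * E₀ * C₉ ^ 2 * K₀' * K₁ + 32 * E₀ * C₉ ^ 2 * Real.exp (B12Decay510.delta1 δ₀ κ Mg * Mg * c₁) * K₀' * K₁) (B12Decay510.delta1 δ₀ κ Mg * cR) := by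
  intro F a₀ ε₂₉ γ₀ α₀ α₁ hα₀ hα₁ Mc Nin Rsep cR hcR hcR4 ιC h8 hsw h9
  exact kstep_joinT_at_record_G hE₀ hκ hC₉ hδ₀ hMg hK₀' F a₀ ε₂₉ γ₀ α₀ α₁ hα₀ hα₁ Mc Nin Rsep cR hcR hcR4 ιC
    (fun k n a => recordGkLocWξ F (thetaFill F a₀ ε₂₉) k (recordK₀ F Mc k + n) Finset.univ a) h8 hsw
    (fun k => ⟨fun a => (h9 k).1 a, (h9 k).2.1, (h9 k).2.2⟩)

/-! ## §4  ★★★ Composition with PTB-1: (Tok-cmpU-cap) discharges the D9 row -/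

/-- **(Tok-cmpU-cap)** — the displayed window-vs-whole-torus comparison token for the transverse table `recordHrLocξ`, VERBATIM the hypothesis `hcmp` of ★★★ PTB-1
✓`PortU8.portPieceLocalityU8_LocUniv_of_cmp` (four clauses at rate `e^{−δ₉(R0−R3)}` inside the inner window); named here only to be passed on.  Asserted for nothing.
[cite: Balaban1984PropagatorsII, (2.130) p.246, (2.148)–(2.150) p.249; Balaban1985Variational, (190) p.308] -/
def TokCmpUCap (F : T4Family) (Mc : ℕ) (a₀ : ℝ) : Prop :=
  ∃ C₉' δ₉ : ℝ, 0 ≤ C₉' ∧ 0 < δ₉ ∧ ∀ (k n : ℕ) (ε₂₉ : ℝ), 0 < ε₂₉ → letI θ := thetaFill F a₀ ε₂₉; letI := θ.instVβ₁; letI := θ.instVβ₂; letI := θ.instιβ;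
      ∀ (a : θ.ιβ) (μ : Fin (F.P (recordK₀ F Mc k + n)).d) (y : Site (F.P (recordK₀ F Mc k + n)) (k + 1)),
      ∀ R3 R0 : ℕ, R3 + nestRadius Mc 1 ≤ R0 → 2 * (R0 + 1) < (F.P (recordK₀ F Mc k + n)).sitesPerDir (k + 1) → ∀ z₀ : Fin 4 → ℤ, y ∈ recordWindow F k (recordK₀ F Mc k + n) R3 z₀ →
      letI Hd : PBond (F.P (recordK₀ F Mc k + n)) 0 → Fin 2 → Fin 2 → ℂ := fun b' => recordHrLocξ F θ k (recordK₀ F Mc k + n) Finset.univ a (μ, y) b' -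
        recordHrLocξ F θ k (recordK₀ F Mc k + n) (recordWindow F k (recordK₀ F Mc k + n) R0 z₀) a (μ, y) b';
      ∀ b : PBond (F.P (recordK₀ F Mc k + n)) 0, coarsenTo (k + 1) b.src ∈ recordWindow F k (recordK₀ F Mc k + n) R3 z₀ →
        ‖Hd b‖ ≤ C₉' * (F.P (recordK₀ F Mc k + n)).eta (k + 1) * Real.exp (-(δ₉ * ((R0 : ℝ) - (R3 : ℝ)))) ∧
        (∀ ν : Fin (F.P (recordK₀ F Mc k + n)).d, ‖Hd ⟨b.src.shift ν, b.dir⟩ - Hd b‖ ≤ C₉' * (F.P (recordK₀ F Mc k + n)).eta (k + 1) ^ 2 * Real.exp (-(δ₉ * ((R0 : ℝ) - (R3 : ℝ))))) ∧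
        ‖∑ ν : Fin (F.P (recordK₀ F Mc k + n)).d, (Hd ⟨b.src.shift ν, b.dir⟩ - (2 : ℂ) • Hd b + Hd ⟨b.src.unshift ν, b.dir⟩)‖ ≤
          C₉' * (F.P (recordK₀ F Mc k + n)).eta (k + 1) ^ 3 * Real.exp (-(δ₉ * ((R0 : ℝ) - (R3 : ℝ)))) ∧
        ‖∑ ν : Fin (F.P (recordK₀ F Mc k + n)).d, ((Hd ⟨b.src, b.dir⟩ + Hd ⟨(b.src).shift b.dir, ν⟩ - Hd ⟨(b.src).shift ν, b.dir⟩ - Hd ⟨b.src, ν⟩) -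
          (Hd ⟨b.src.unshift ν, b.dir⟩ + Hd ⟨(b.src.unshift ν).shift b.dir, ν⟩ - Hd ⟨(b.src.unshift ν).shift ν, b.dir⟩ - Hd ⟨b.src.unshift ν, ν⟩))‖ ≤
          C₉' * (F.P (recordK₀ F Mc k + n)).eta (k + 1) ^ 3 * Real.exp (-(δ₉ * ((R0 : ℝ) - (R3 : ℝ))))

end Summit.QuantumFields.YangMills.Theorems.K0AxJoinT

end
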